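import Mathlib
import Summits.NavierStokesRegularity.NavierStokesRegularity.Theorems.StretchingWellBindingEnstrophyQuarterLawSieveCore
import Summits.NavierStokesRegularity.NavierStokesRegularity.Theorems.StretchingWellBindingEnstrophyQuarterLawEarlySlab
import HarnessLib

/-!
# Shelf crux `EnstrophyQuarterLaw` (stmt-NavierStokesRegularity-1574), line «sparse_sieve»:
# the SIEVE LEMMA `stub_sieve` (part 5 of 5)

Theorems file (seat ns-hhe-c1 g2; `--supports` the shelf crux; the registered stub `stub_sieve` of
the skeleton of record `Cruxes/EnstrophyQuarterLaw/Lines/sparse_sieve.lean`, whose five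
Cruxes-local predicates `UniformLocalTypeI`, `UniformSparseness`, `SmoothingEnvelope`,
`FarFieldEnstrophy`, `WindowLaw` are UNFOLDED VERBATIM because a Theorems file cannot import the
skeleton; the stub closes there by `exact Theorems.EnstrophyQuarterLaw.SparseSieve.stub_sieve …`).
Navier–Stokes regularity is NOT proved by anything here: the window quarter law (item 25161) and the
slice quarter law (item 1574) stay OPEN — the lemma reduces them to the two OPEN velocity-side
hypotheses `UniformLocalTypeI` (CKN-Type-I) and `UniformSparseness` (no satellite swarms) plus the
two KNOWN pieces (localized smoothing envelope; far-field enstrophy, landed p607039).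

## Assembly

`|curl v| ≤ ‖curlCLM‖ ‖Dv‖` (`enorm_curl_sq_le_opNorm`) puts the core `B(0,ρ) × [T/2, T]` in the
form of `core_window_bound` (the dyadic sieve, previous file); the far field costs `B τ`
(`FarFieldEnstrophy`); early windows `(a, b) ⊆ [0, T/2]` cost `B₀ τ` (tree helper
`earlySlab_enstrophy_bound`, p608347); a short window straddling `T/2` is split there; long windows
are chopped into pieces of length `≤ τ₀` (`window_bound_of_short_windows`). All constants are
existential (`∃ K`), as in the registered statement.
-/

noncomputable section

-- the summit and its single sub-problem share the name (CONVENTIONS §1), as in every Theorems file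
set_option linter.dupNamespace false

namespace Summit.NavierStokesRegularity.NavierStokesRegularity.Theorems.EnstrophyQuarterLaw.SparseSieve

open MeasureTheory Set Metric Finset Filter Topology Function
open Literature.Analysis Literature.Analysis.FluidPDE
open scoped ENNReal NNReal

/-! ### The registered stub `stub_sieve` -/

/-- **The sieve lemma** — the registered stub `stub_sieve` of line «sparse_sieve» on the shelf
crux `EnstrophyQuarterLaw` (stmt-NavierStokesRegularity-1574; also stub 5 of the line on item
stmt-NavierStokesRegularity-25161), with the Cruxes-local predicates `UniformLocalTypeI`,
`UniformSparseness`, `SmoothingEnvelope`, `FarFieldEnstrophy`, `WindowLaw` UNFOLDED VERBATIM (in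
this order, as the last five hypotheses / the conclusion): for a maximal classical solution on
`[0, T)`, Leray–Hopf from a rapidly decaying datum, uniform local Type I (CKN `A`, `E` at scales
`≤ r₀`) + uniform sparseness of `L³`-concentration at every threshold + the localized smoothing
envelope + the far-field enstrophy bound imply the WINDOW QUARTER LAW
`∫_a^b ∫ |curl u|² ≤ K √(b − a)`, `0 ≤ a ≤ b ≤ T`. Proof: `core_window_bound` (the dyadic sieve) on
the core `B(0, ρ) × [T/2, T]`, `|curl v| ≤ ‖curlCLM‖ ‖Dv‖`, the far field, the early slab
(`earlySlab_enstrophy_bound`), a split at `T/2`, and chopping of long windows. HONEST FRAMING: a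
reduction between properties of a HYPOTHETICAL blow-up; the two open hypotheses are not claimed. [folklore] -/
theorem stub_sieve : ∀ (ν T : ℝ), 0 < ν → 0 < T →
    ∀ (u : ℝ → EuclideanSpace ℝ (Fin 3) → EuclideanSpace ℝ (Fin 3))
      (p : ℝ → EuclideanSpace ℝ (Fin 3) → ℝ),
    IsMaximalSmoothSolution ν 0 u p T → IsLerayHopfOn T ν 0 (u 0) u →
    HasRapidSpatialDecay (u 0) →
    (∃ M r₀ : ℝ, 0 < M ∧ 0 < r₀ ∧
      (∀ s ∈ Set.Ico 0 T, ∀ (x : EuclideanSpace ℝ (Fin 3)), ∀ R ∈ Set.Ioc 0 r₀,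
        ∫⁻ y in Metric.ball x R, ‖u s y‖ₑ ^ 2 ≤ ENNReal.ofReal (M * R)) ∧
      (∀ b ∈ Set.Ioc 0 T, ∀ (x : EuclideanSpace ℝ (Fin 3)), ∀ R ∈ Set.Ioc 0 r₀, R ^ 2 ≤ b →
        ∫⁻ t in Set.Ioo (b - R ^ 2) b, ∫⁻ y in Metric.ball x R, ‖fderiv ℝ (u t) y‖ₑ ^ 2 ≤
          ENNReal.ofReal (M * R))) →
    (∃ r₀ : ℝ, 0 < r₀ ∧ ∀ ε₀ : ℝ, 0 < ε₀ → ∃ N₀ : ℕ,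
      ∀ t ∈ Set.Ico 0 T, ∀ r ∈ Set.Ioc 0 r₀, ∀ F : Finset (EuclideanSpace ℝ (Fin 3)),
        (∀ x ∈ F, ∀ y ∈ F, x ≠ y → 4 * r ≤ dist x y) →
        (∀ x ∈ F, ENNReal.ofReal (ε₀ ^ 3) ≤ ∫⁻ y in Metric.ball x (2 * r), ‖u t y‖ₑ ^ 3) →
        F.card ≤ N₀) →
    (∀ M r₀ : ℝ, 0 < M → 0 < r₀ →
      (∀ s ∈ Set.Ico 0 T, ∀ (x : EuclideanSpace ℝ (Fin 3)), ∀ R ∈ Set.Ioc 0 r₀,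
        ∫⁻ y in Metric.ball x R, ‖u s y‖ₑ ^ 2 ≤ ENNReal.ofReal (M * R)) →
      ∃ γ σ C : ℝ, 0 < γ ∧ 0 < σ ∧ 0 ≤ C ∧
        ∀ (b R : ℝ) (x₀ : EuclideanSpace ℝ (Fin 3)), 0 < R → R ≤ r₀ → 0 ≤ b - σ * R ^ 2 → b ≤ T →
          ∫⁻ y in Metric.ball x₀ (2 * R), ‖u (b - σ * R ^ 2) y‖ₑ ^ 3 ≤ ENNReal.ofReal (γ ^ 3) →
          ∀ t₁ ∈ Set.Ico (b - σ * R ^ 2 / 4) b,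
            ∫⁻ t in Set.Ioo t₁ b, ∫⁻ y in Metric.ball x₀ (R / 4), ‖fderiv ℝ (u t) y‖ₑ ^ 2 ≤
              ENNReal.ofReal (C * (b - t₁) / R)) →
    (∃ ρ B : ℝ, 0 ≤ B ∧ ∀ t ∈ Set.Ico (T / 2) T,
      ∫⁻ x in (Metric.ball (0 : EuclideanSpace ℝ (Fin 3)) ρ)ᶜ, ‖curl (u t) x‖ₑ ^ 2 ≤
        ENNReal.ofReal B) →
    ∃ K : ℝ, ∀ a b : ℝ, 0 ≤ a → a ≤ b → b ≤ T →
      ∫⁻ t in Set.Ioo a b, ∫⁻ x, ‖curl (u t) x‖ₑ ^ 2 ≤ ENNReal.ofReal (K * Real.sqrt (b - a)) := by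
  intro ν T hν hT u p hmax hLH hdec hTI hSp hSE hFF
  obtain ⟨M, r₀, hM, hr₀, hA, hE⟩ := hTI
  obtain ⟨γ, σ, C, hγ, hσ, hC, hS⟩ := hSE M r₀ hM hr₀ hA
  obtain ⟨r₁, hr₁, hN⟩ := hSp
  obtain ⟨N₀, hN₀⟩ := hN γ hγ
  obtain ⟨ρ, B, hB, hfar⟩ := hFF
  have hcl : IsClassicalNSSolutionOn (Ico 0 T) ν 0 u p := hmax.1
  have hu : IsSmoothSpaceTimeOn (Ico 0 T) u := hcl.smooth_velocity
  obtain ⟨B₀, hB₀, hearly⟩ := earlySlab_enstrophy_bound hν hcl hLH hdec (t₁ := T / 2)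
    (by positivity) (by linarith)
  obtain ⟨Kc, τ₀, hKc, hτ₀, hcore⟩ := core_window_bound hT hu hM.le hr₀ hE hσ hC hS hr₁ hN₀ ρ
  -- the curl constant and the enstrophy `Φ`
  set cc : ℝ := ‖(curlCLM : (EuclideanSpace ℝ (Fin 3) →L[ℝ] EuclideanSpace ℝ (Fin 3)) →L[ℝ]
    EuclideanSpace ℝ (Fin 3))‖ ^ 2 with hcc
  have hcc0 : 0 ≤ cc := sq_nonneg _
  have hsqrt_le : ∀ a b : ℝ, a ≤ b → b - a ≤ T → b - a ≤ Real.sqrt T * Real.sqrt (b - a) := by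
    intro a b hab hbaT
    have hba : 0 ≤ b - a := sub_nonneg.2 hab
    calc b - a = Real.sqrt (b - a) * Real.sqrt (b - a) := (Real.mul_self_sqrt hba).symm
      _ ≤ Real.sqrt T * Real.sqrt (b - a) :=
          mul_le_mul_of_nonneg_right (Real.sqrt_le_sqrt hbaT) (Real.sqrt_nonneg _)
  -- ### early windows `(a, b) ⊆ [0, T/2]`
  have hearlyW : ∀ a b : ℝ, 0 ≤ a → a ≤ b → b ≤ T / 2 →
      ∫⁻ t in Ioo a b, ∫⁻ x, ‖curl (u t) x‖ₑ ^ 2 ≤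
        ENNReal.ofReal (B₀ * Real.sqrt T * Real.sqrt (b - a)) := by
    intro a b ha hab hb
    have h1 : ∫⁻ t in Ioo a b, ∫⁻ x, ‖curl (u t) x‖ₑ ^ 2 ≤ ENNReal.ofReal B₀ * ENNReal.ofReal (b - a) :=
      setLIntegral_Ioo_le_of_le fun t ht => hearly t ⟨ha.trans ht.1.le, ht.2.le.trans hb⟩
    refine h1.trans ?_
    rw [← ENNReal.ofReal_mul hB₀]
    refine ENNReal.ofReal_le_ofReal ?_
    rw [mul_assoc]
    exact mul_le_mul_of_nonneg_left (hsqrt_le a b hab (by linarith)) hB₀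
  -- ### late short windows `(a, b) ⊆ [T/2, T]`: far field + the sieve on the core
  have hlateW : ∀ a b : ℝ, T / 2 ≤ a → a < b → b ≤ T → b - a ≤ τ₀ →
      ∫⁻ t in Ioo a b, ∫⁻ x, ‖curl (u t) x‖ₑ ^ 2 ≤
        ENNReal.ofReal ((cc * Kc + B * Real.sqrt T) * Real.sqrt (b - a)) := by
    intro a b ha hab hb hτ
    have ha0 : 0 ≤ a := le_trans (by positivity) ha
    have hba : 0 ≤ b - a := by linarith
    have hsl : ∀ t ∈ Ioo a b, ∫⁻ x, ‖curl (u t) x‖ₑ ^ 2 ≤ ENNReal.ofReal cc *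
        (∫⁻ x in ball (0 : EuclideanSpace ℝ (Fin 3)) ρ, ‖fderiv ℝ (u t) x‖ₑ ^ 2) +
        ENNReal.ofReal B := by
      intro t ht
      have htI : t ∈ Ico (T / 2) T := ⟨ha.trans ht.1.le, lt_of_lt_of_le ht.2 hb⟩
      rw [← lintegral_add_compl (fun x => ‖curl (u t) x‖ₑ ^ 2)
        (measurableSet_ball (x := (0 : EuclideanSpace ℝ (Fin 3))) (ε := ρ))]
      refine add_le_add ?_ (hfar t htI)
      rw [← lintegral_const_mul' _ _ ENNReal.ofReal_ne_top]
      exact lintegral_mono fun x => enorm_curl_sq_le_opNorm (u t) x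
    have hmeas : AEMeasurable (fun t => ∫⁻ x in ball (0 : EuclideanSpace ℝ (Fin 3)) ρ,
        ‖fderiv ℝ (u t) x‖ₑ ^ 2) (volume.restrict (Ioo a b)) :=
      aemeasurable_setLIntegral_enorm_fderiv_sq hu ha0 hb _
    have hcoreab := hcore a b ha hab hb hτ
    have hn1 : 0 ≤ cc * (Kc * Real.sqrt (b - a)) := mul_nonneg hcc0 (mul_nonneg hKc (Real.sqrt_nonneg _))
    have hn2 : 0 ≤ B * (b - a) := mul_nonneg hB hba
    calc ∫⁻ t in Ioo a b, ∫⁻ x, ‖curl (u t) x‖ₑ ^ 2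
        ≤ ∫⁻ t in Ioo a b, (ENNReal.ofReal cc *
            (∫⁻ x in ball (0 : EuclideanSpace ℝ (Fin 3)) ρ, ‖fderiv ℝ (u t) x‖ₑ ^ 2) +
            ENNReal.ofReal B) := setLIntegral_mono' measurableSet_Ioo hsl
      _ = ENNReal.ofReal cc * (∫⁻ t in Ioo a b, ∫⁻ x in ball (0 : EuclideanSpace ℝ (Fin 3)) ρ,
            ‖fderiv ℝ (u t) x‖ₑ ^ 2) + ENNReal.ofReal B * ENNReal.ofReal (b - a) := by
          rw [lintegral_add_left' (hmeas.const_mul _), lintegral_const_mul' _ _ ENNReal.ofReal_ne_top,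
            setLIntegral_const, Real.volume_Ioo]
      _ ≤ ENNReal.ofReal cc * ENNReal.ofReal (Kc * Real.sqrt (b - a)) +
            ENNReal.ofReal B * ENNReal.ofReal (b - a) :=
          add_le_add (mul_le_mul' le_rfl hcoreab) le_rfl
      _ = ENNReal.ofReal (cc * (Kc * Real.sqrt (b - a)) + B * (b - a)) := by
          rw [← ENNReal.ofReal_mul hcc0, ← ENNReal.ofReal_mul hB, ← ENNReal.ofReal_add hn1 hn2]
      _ ≤ ENNReal.ofReal ((cc * Kc + B * Real.sqrt T) * Real.sqrt (b - a)) := by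
          refine ENNReal.ofReal_le_ofReal ?_
          have h1 : B * (b - a) ≤ B * (Real.sqrt T * Real.sqrt (b - a)) :=
            mul_le_mul_of_nonneg_left (hsqrt_le a b hab.le (by linarith)) hB
          have e : (cc * Kc + B * Real.sqrt T) * Real.sqrt (b - a) =
              cc * (Kc * Real.sqrt (b - a)) + B * (Real.sqrt T * Real.sqrt (b - a)) := by ring
          rw [e]; linarith
  -- ### every short window in `[0, T]` (split at `T/2` if necessary)
  set Ks : ℝ := B₀ * Real.sqrt T + (cc * Kc + B * Real.sqrt T) with hKs
  have hKe0 : 0 ≤ B₀ * Real.sqrt T := mul_nonneg hB₀ (Real.sqrt_nonneg _)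
  have hKl0 : 0 ≤ cc * Kc + B * Real.sqrt T :=
    add_nonneg (mul_nonneg hcc0 hKc) (mul_nonneg hB (Real.sqrt_nonneg _))
  have hKs0 : 0 ≤ Ks := add_nonneg hKe0 hKl0
  have hKs1 : B₀ * Real.sqrt T ≤ Ks := le_add_of_nonneg_right hKl0
  have hKs2 : cc * Kc + B * Real.sqrt T ≤ Ks := le_add_of_nonneg_left hKe0
  have hshort : ∀ a b : ℝ, 0 ≤ a → a < b → b ≤ T → b - a ≤ τ₀ →
      ∫⁻ t in Ioo a b, ∫⁻ x, ‖curl (u t) x‖ₑ ^ 2 ≤ ENNReal.ofReal (Ks * Real.sqrt (b - a)) := by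
    intro a b ha hab hb hτ
    rcases le_or_gt b (T / 2) with hbm | hbm
    · exact (hearlyW a b ha hab.le hbm).trans
        (ENNReal.ofReal_le_ofReal (mul_le_mul_of_nonneg_right hKs1 (Real.sqrt_nonneg _)))
    rcases le_or_gt (T / 2) a with ham | ham
    · exact (hlateW a b ham hab hb hτ).trans
        (ENNReal.ofReal_le_ofReal (mul_le_mul_of_nonneg_right hKs2 (Real.sqrt_nonneg _)))
    -- the window straddles `T/2`
    have hsub : Ioo a b ⊆ Ioo a (T / 2) ∪ Ico (T / 2) b := fun t ht => by
      rcases lt_or_ge t (T / 2) with h1 | h1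
      · exact Or.inl ⟨ht.1, h1⟩
      · exact Or.inr ⟨h1, ht.2⟩
    have hIco : ∫⁻ t in Ico (T / 2) b, ∫⁻ x, ‖curl (u t) x‖ₑ ^ 2 =
        ∫⁻ t in Ioo (T / 2) b, ∫⁻ x, ‖curl (u t) x‖ₑ ^ 2 := setLIntegral_congr Ioo_ae_eq_Ico.symm
    have h1 := hearlyW a (T / 2) ha ham.le le_rfl
    have h2 := hlateW (T / 2) b le_rfl hbm hb (by linarith)
    have h1' : B₀ * Real.sqrt T * Real.sqrt (T / 2 - a) ≤ B₀ * Real.sqrt T * Real.sqrt (b - a) :=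
      mul_le_mul_of_nonneg_left (Real.sqrt_le_sqrt (by linarith)) hKe0
    have h2' : (cc * Kc + B * Real.sqrt T) * Real.sqrt (b - T / 2) ≤
        (cc * Kc + B * Real.sqrt T) * Real.sqrt (b - a) :=
      mul_le_mul_of_nonneg_left (Real.sqrt_le_sqrt (by linarith)) hKl0
    calc ∫⁻ t in Ioo a b, ∫⁻ x, ‖curl (u t) x‖ₑ ^ 2
        ≤ ∫⁻ t in Ioo a (T / 2) ∪ Ico (T / 2) b, ∫⁻ x, ‖curl (u t) x‖ₑ ^ 2 := lintegral_mono_set hsub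
      _ ≤ (∫⁻ t in Ioo a (T / 2), ∫⁻ x, ‖curl (u t) x‖ₑ ^ 2) +
            ∫⁻ t in Ico (T / 2) b, ∫⁻ x, ‖curl (u t) x‖ₑ ^ 2 := lintegral_union_le _ _ _
      _ ≤ ENNReal.ofReal (B₀ * Real.sqrt T * Real.sqrt (b - a)) +
            ENNReal.ofReal ((cc * Kc + B * Real.sqrt T) * Real.sqrt (b - a)) := by
          rw [hIco]
          exact add_le_add (h1.trans (ENNReal.ofReal_le_ofReal h1'))
            (h2.trans (ENNReal.ofReal_le_ofReal h2'))
      _ = ENNReal.ofReal (Ks * Real.sqrt (b - a)) := by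
          rw [← ENNReal.ofReal_add (mul_nonneg hKe0 (Real.sqrt_nonneg _))
            (mul_nonneg hKl0 (Real.sqrt_nonneg _))]
          congr 1
          rw [hKs]; ring
  -- ### chop long windows
  have hchop := window_bound_of_short_windows (Φ := fun t => ∫⁻ x, ‖curl (u t) x‖ₑ ^ 2)
    (T₁ := 0) (T₂ := T) hτ₀ hKs0 (fun a b ha hab hb hτ => hshort a b ha hab hb hτ)
  exact ⟨((⌈(T - 0) / τ₀⌉₊ + 1 : ℕ) : ℝ) * Ks, fun a b ha hab hb => hchop a b ha hab hb⟩

end Summit.NavierStokesRegularity.NavierStokesRegularity.Theorems.EnstrophyQuarterLaw.SparseSieve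

end
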